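import Summits.CriticalPhenomena.CardyFormulaZ2.Theorems.CardyIKTransportIKLinearTransportStubCrudeCardySiteTriPart1
import Literature.Probability.Percolation.TriApproxDomainAssembly

/-!
# Crude Cardy for site percolation on `𝕋` with general slack — Part 2: the level-`ε` upper bound and
# the dominating discrete approximation

Support file (`--supports stmt-CriticalPhenomena-5076`) of the line `pinned-diagram-exchange` of the crux
`CardyIKTransport.IKLinearTransport` (stmt-CriticalPhenomena-5076), stub `stub_CrudeCardySiteTri`,
continuing Part 1. The CRUDE crossing event of a conformal rectangle `R = (Ω; A₁, A₂, A₃, A₄)` at mesh `δ`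
with slack `s` is `{∃ u v, infDist (δu) A₁ ≤ sδ ∧ infDist (δv) A₃ ≤ sδ ∧ u ↔ v by an open 𝕋-path with all
sites in Ω}` (written out in the statements; no definition is introduced).

* `level_crude` — the analogue of `level_p` (`TriCollarSandwichLevel.lean`) for the crude event: at level
  `ε`, for all small `δ`, the shorter–fatter marked inner approximation `G⁺` of `level_core` satisfies
  `P(crude_s(R, δ)) ≤ P(G⁺ has an open crossing from arc 0 to arc 2) + ε`. Away from the corners (Claim 20,
  Lemma 4: `walk_far_or_annulus`, `tri_annulusCrossing_bound_holds`) a crude path starts off `G⁺` within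
  `sδ < m` of `A₁` (the macroscopic margin `m` of `exists_le_infDist_arc_of_mem_collar`), its off-`G⁺`
  sites are within the tube tolerance of `A₁ ∪ A₃` (Part 1, `near_arcs_of_not_mem_fill`, through the filled
  compact swallowed by `exists_forall_mem_innerApprox`), and `isOpenCrossing_of_run` (Part 1) extracts an
  open crossing of `G⁺`.
* `exists_discreteApprox_crude` — diagonal selection of levels exactly as in `tri_exists_discreteApprox_proof`
  (`TriApproxDomainAssembly.lean`): an `IsDiscreteApprox` family `G⁺_δ` with
  `P(crude_s(R, δ)) ≤ P_δ(G⁺_δ) + e(δ)`, `e → 0`.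

References: B. Bollobás, O. Riordan, *Percolation*, CUP (2006), Ch. 7, Lemma 14 p. 184 with (19), proof
p. 195, Claims 20–21 pp. 192–193, Lemma 4 p. 166; S. Smirnov, C. R. Acad. Sci. Paris 333 (2001), §2.
-/

noncomputable section

namespace Summit.CriticalPhenomena.CardyFormulaZ2.Theorems.IKLinearTransport.PinnedDiagramExchange

open scoped BigOperators Topology Classical MeasureTheory
open Filter Set Function MeasureTheory Metric
open Literature.Probability.Percolation Literature.Probability.LatticeModels
open Literature.Probability.RandomPlanarGeometry

/-! ## §3 The level-`ε` upper bound for the crude crossing event -/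

set_option maxHeartbeats 400000 in
/-- **Level `ε`, crude upper half.** For `R` with boundary of index `1`, a slack `s ≥ 0` and `ε > 0`: a
width `h ≤ ε` of the "shorter, fatter" collar domain and `δ₀ > 0` such that for every `δ < δ₀` the
level marked inner approximation `G⁺` has arcs mutually within `2ε` of the arcs of `R`, fills
`Φ(B̄(0, 1 - 2ε))`, has `2ε`-dense face centres, and the CRUDE crossing event — an open `𝕋`-path with
all sites in `Ω` from a site within `sδ` of `A₁` to a site within `sδ` of `A₃` — has probability at most
`P(G⁺ has an open crossing from arc 0 to arc 2) + ε`: away from the corners such a path enters `G⁺`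
across its discrete arc `0` and leaves across its discrete arc `2` (`isOpenCrossing_of_run`), the corner
events being discounted by Lemma 4. [cite: BollobasRiordan2006, Ch. 7 Lemma 14 (19) p. 184, Claim 20 p. 192, Lemma 4 p. 166] -/
theorem level_crude (R : ConformalRectangle) (T : R.toJordanDomain.TubeData) (hR1 : ∀ z ∈ R.carrier, R.index z = 1)
    {s : ℝ} (hs : 0 ≤ s) {ε : ℝ} (hε : 0 < ε) :
    ∃ (h : ℝ) (hh : 0 < h) (hh1 : h ≤ 1 / 2), h ≤ ε ∧
      T.z₀ ∈ (R.collarRect T (MarkedDomain.abs_le_one_of_sign σp_sign) hh hh1).carrier ∧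
      ∃ δ₀ > 0, ∀ δ : ℝ, ∀ hδ : 0 < δ, δ < δ₀ →
        ∃ hc₀ : baseSite T.z₀ δ ∈ innerCoarse (R.collarRect T (MarkedDomain.abs_le_one_of_sign σp_sign) hh hh1).carrier δ,
        ∃ G : TriMarkedDomain 4,
          G.verts = (innerApprox (R.collarRect T (MarkedDomain.abs_le_one_of_sign σp_sign) hh hh1).toJordanDomain hδ hc₀).verts ∧
          (∀ i : Fin 4, (∀ y ∈ G.arc i, ∃ z ∈ R.arc i, dist (triMeshPoint δ y) z < 2 * ε) ∧
            ∀ z ∈ R.arc i, ∃ y ∈ G.arc i, dist (triMeshPoint δ y) z < 2 * ε) ∧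
          (∀ x : Site 2, triMeshPoint δ x ∈ T.Ci.Φ '' closedBall (0 : ℂ) (1 - 2 * ε) → x ∈ G.verts) ∧
          (∀ z ∈ closure R.carrier, ∃ w ∈ G.faces, dist z ((δ : ℂ) * hexCenter w) < 2 * ε) ∧
          (triSitePercolation half).real {ω | ∃ u v : Site 2, infDist (triMeshPoint δ u) (R.arc 0) ≤ s * δ ∧
              infDist (triMeshPoint δ v) (R.arc 2) ≤ s * δ ∧ ω ∈ siteConnIn triGraph (triMeshVertices R.carrier δ) u v} ≤
            G.openCrossingProb 0 2 + ε := by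
  classical
  obtain ⟨carc, hcarc0, hcarc⟩ := R.exists_pos_le_infDist_pt_arc
  obtain ⟨α, hα, hbound⟩ := tri_annulusCrossing_bound_holds
  set ε' := min ε (carc / 4) with hε'
  have hε'0 : 0 < ε' := lt_min hε (by linarith)
  have hε'ε : ε' ≤ ε := min_le_left _ _
  have hε'c : ε' ≤ carc / 4 := min_le_right _ _
  set r₂ := carc / 3 with hr₂
  obtain ⟨ρ, hρ, hρε, hρr, hρα⟩ := exists_corner_radius (r₂ := r₂) hα (by positivity) hε'0
  obtain ⟨κ, hκ0, hκ⟩ := R.exists_dist_boundary_lt (show (0 : ℝ) < ρ / 4 by positivity)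
  obtain ⟨d₁, hd₁, hsep⟩ := R.exists_sep_arcs (half_pos hκ0)
  obtain ⟨d₀₂, hd₀₂, hd02⟩ := R.exists_pos_forall_lt_dist_arc
  obtain ⟨ηc, hηc0, hηc⟩ := R.exists_corner_modulus (half_pos hρ)
  have hdZ := R.toJordanDomain.infDist_frontier_pos T.hz₀
  set dZ := infDist T.z₀ (frontier R.carrier) with hdZdef
  set tol := min (min (ρ / 16) (ηc / 2)) (min (min (d₁ / 8) (d₀₂ / 8)) (dZ / 2)) with htol
  have htol0 : 0 < tol := by positivity
  have htolρ : tol ≤ ρ / 16 := (min_le_left _ _).trans (min_le_left _ _)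
  have htolη : tol ≤ ηc / 2 := (min_le_left _ _).trans (min_le_right _ _)
  have htold₁ : tol ≤ d₁ / 8 := (min_le_right _ _).trans ((min_le_left _ _).trans (min_le_left _ _))
  have htold₀₂ : tol ≤ d₀₂ / 8 := (min_le_right _ _).trans ((min_le_left _ _).trans (min_le_right _ _))
  have htolZ : tol ≤ dZ / 2 := (min_le_right _ _).trans (min_le_right _ _)
  obtain ⟨h₁, hh₁, -, hdist₁⟩ := T.exists_dist_tube_lt htol0
  set ε₁ := min ε' (min (h₁ / 4) (min (d₁ / 8) (d₀₂ / 8))) with hε₁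
  have hε₁0 : 0 < ε₁ := by positivity
  have hε₁ε' : ε₁ ≤ ε' := min_le_left _ _
  have hε₁h₁ : ε₁ ≤ h₁ / 4 := (min_le_right _ _).trans (min_le_left _ _)
  have hε₁d₁ : ε₁ ≤ d₁ / 8 := (min_le_right _ _).trans ((min_le_right _ _).trans (min_le_left _ _))
  have hε₁d₀₂ : ε₁ ≤ d₀₂ / 8 := (min_le_right _ _).trans ((min_le_right _ _).trans (min_le_right _ _))
  obtain ⟨h, hh, hh1, hhε, hz₀, δ₀, hδ₀, t, -, -, hlev⟩ := level_core R T σp_sign hR1 hε₁0 hρ one_pos hcarc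
  have hσ := MarkedDomain.abs_le_one_of_sign σp_sign
  have hdist : ∀ s' t', 1 - h ≤ s' → s' ≤ 1 + h → dist (T.tube s' t') (R.boundary t') < tol := fun s' t' h1 h2 =>
    hdist₁ s' t' (by linarith) (by linarith)
  have hdist2 : ∀ s' t', 1 - 2 * h ≤ s' → s' ≤ 1 → dist (T.tube s' t') (R.boundary t') < tol := fun s' t' h1 h2 =>
    hdist₁ s' t' (by linarith) (by linarith)
  have hclose : ∀ t', dist (R.collarLoop T σp h t') (R.boundary t') < infDist T.z₀ (frontier R.carrier) := fun t' => by
    have := R.profile_mem hσ hh t'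
    exact (hdist _ _ (by linarith [this.1]) (by linarith [this.2])).trans_le (by linarith)
  obtain ⟨m, hm, hpull⟩ := R.exists_le_infDist_arc_of_mem_collar T σp_sign hh hh1 hρ hηc (by linarith) (by linarith) hdist
  have hK'c := isCompact_fill R T hh.le κ
  have hK'D := fill_subset_collarRect R T hh hh1 hclose hκ0
  obtain ⟨δB, hδB, hswallow⟩ := exists_forall_mem_innerApprox
    (R.collarRect T (MarkedDomain.abs_le_one_of_sign σp_sign) hh hh1).toJordanDomain hz₀ hK'c hK'D
  refine ⟨h, hh, hh1, hhε.trans (hε₁ε'.trans hε'ε), hz₀,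
    min (min δ₀ δB) (min (min (m / (s + 2)) (tol / (s + 2))) (ρ / 1000)), by positivity, fun δ hδ hδlt => ?_⟩
  have hδ₀' : δ < δ₀ := hδlt.trans_le ((min_le_left _ _).trans (min_le_left _ _))
  have hδB' : δ < δB := hδlt.trans_le ((min_le_left _ _).trans (min_le_right _ _))
  have hδm : δ < m / (s + 2) := hδlt.trans_le ((min_le_right _ _).trans ((min_le_left _ _).trans (min_le_left _ _)))
  have hδtol : δ < tol / (s + 2) := hδlt.trans_le ((min_le_right _ _).trans ((min_le_left _ _).trans (min_le_right _ _)))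
  have hδρ : δ < ρ / 1000 := hδlt.trans_le ((min_le_right _ _).trans (min_le_right _ _))
  have hsδm : s * δ < m := by
    have := (lt_div_iff₀ (by positivity : (0 : ℝ) < s + 2)).1 hδm
    nlinarith
  have hsδtol : s * δ + 2 * δ < tol := by
    have := (lt_div_iff₀ (by positivity : (0 : ℝ) < s + 2)).1 hδtol
    nlinarith
  have hsδ0 : 0 ≤ s * δ := mul_nonneg hs hδ.le
  obtain ⟨hc₀, G, hGv, harcs, -, -, -, -, hfill, hdense⟩ := hlev δ hδ hδ₀'
  obtain ⟨hc₀', hK⟩ := hswallow δ hδ hδB'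
  have hKG : ∀ x : Site 2, triMeshPoint δ x ∈ T.Ci.Φ '' closedBall (0 : ℂ) (1 - 2 * h) ∪ (fun q : ℝ × ℝ => T.tube q.1 q.2) ''
      (Icc (0 : ℝ) 1 ×ˢ (Icc (R.mark 1 + κ / 2) (R.nextMark 1 - κ / 2) ∪ Icc (R.mark 3 + κ / 2) (R.nextMark 3 - κ / 2))) →
      x ∈ G.verts := fun x hx => by
    rw [hGv]; exact hK x hx
  refine ⟨hc₀, G, hGv, fun i => ⟨fun y hy => ?_, fun z hz => ?_⟩, fun x hx => hfill x ?_, fun z hz => ?_, ?_⟩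
  · obtain ⟨z, hz, hd⟩ := (harcs i).1 y hy; exact ⟨z, hz, by linarith⟩
  · obtain ⟨y, hy, hd⟩ := (harcs i).2 z hz; exact ⟨y, hy, by linarith⟩
  · obtain ⟨u, hu, hux⟩ := hx
    exact ⟨u, closedBall_subset_closedBall (by linarith) hu, hux⟩
  · obtain ⟨w, hw, hd⟩ := hdense z hz; exact ⟨w, hw, by linarith⟩
  -- sites of `G` in `Ω` away from the corners keep off the arcs `0`, `2` by `m`
  have hGdeep : ∀ x ∈ G.verts, triMeshPoint δ x ∈ (R.collarRect T hσ hh hh1).carrier := fun x hx => by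
    rw [hGv] at hx
    exact innerApprox_deep _ hδ hc₀ x hx (mem_closedBall_self (by positivity))
  have hGfar : ∀ x ∈ G.verts, triMeshPoint δ x ∈ R.carrier → (∀ i, ρ ≤ dist (triMeshPoint δ x) (R.pt i)) →
      m ≤ infDist (triMeshPoint δ x) (R.arc 0) ∧ m ≤ infDist (triMeshPoint δ x) (R.arc 2) := fun x hx hxΩ hfar =>
    ⟨hpull _ (hGdeep x hx) hxΩ hfar 0 (by simp [σp]), hpull _ (hGdeep x hx) hxΩ hfar 2 (by simp [σp])⟩
  -- event inclusion
  have hsub : {ω : SiteConfig (Site 2) | ∃ u v : Site 2, infDist (triMeshPoint δ u) (R.arc 0) ≤ s * δ ∧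
      infDist (triMeshPoint δ v) (R.arc 2) ≤ s * δ ∧ ω ∈ siteConnIn triGraph (triMeshVertices R.carrier δ) u v} ⊆
      G.openCrossing 0 2 ∪ ⋃ i : Fin 4, triAnnulusCrossing true δ (R.pt i) ρ r₂ := by
    rintro ω ⟨u, v, hu, hv, hω⟩
    have hP := mem_siteConnIn_iff_pathIn.1 hω
    obtain ⟨W, hW⟩ := hP.exists_walk
    have hend : ∀ i : Fin 4, r₂ < dist (triMeshPoint δ u) (R.pt i) ∨ r₂ < dist (triMeshPoint δ v) (R.pt i) := by
      have key : ∀ (k j : Fin 4) (p : Site 2), R.pt k ∉ R.arc j → infDist (triMeshPoint δ p) (R.arc j) ≤ s * δ →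
          r₂ < dist (triMeshPoint δ p) (R.pt k) := by
        intro k j p hk hp
        have h1 := hcarc k j hk
        have h2 := infDist_le_infDist_add_dist (s := R.arc j) (x := R.pt k) (y := triMeshPoint δ p)
        rw [dist_comm] at h2
        linarith
      intro i
      fin_cases i
      · exact Or.inr (key 0 2 v (by rw [R.pt_mem_arc_iff]; decide) hv)
      · exact Or.inr (key 1 2 v (by rw [R.pt_mem_arc_iff]; decide) hv)
      · exact Or.inl (key 2 0 u (by rw [R.pt_mem_arc_iff]; decide) hu)
      · exact Or.inl (key 3 0 u (by rw [R.pt_mem_arc_iff]; decide) hu)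
    rcases walk_far_or_annulus R le_rfl (c := true) (ω := ω) W (fun x hx => by simpa using (hW x hx).2) hend
      with hfar | ⟨i, hi⟩
    swap
    · exact Or.inr (mem_iUnion.2 ⟨i, hi⟩)
    left
    -- two `𝕋`-neighbours (or equal sites) near `A₁` and near `A₃` do not exist
    have hexcl : ∀ x y : Site 2, (x = y ∨ triGraph.Adj x y) → infDist (triMeshPoint δ x) (R.arc 0) ≤ tol →
        infDist (triMeshPoint δ y) (R.arc 2) ≤ tol → False := by
      intro x y hxy hx0 hy2
      have hd : dist (triMeshPoint δ x) (triMeshPoint δ y) ≤ δ := by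
        rcases hxy with rfl | hxy
        · rw [dist_self]; exact hδ.le
        · rw [dist_triMeshPoint_of_triGraph_adj hxy, abs_of_pos hδ]
      obtain ⟨a, ha, hxa⟩ := (infDist_lt_iff ⟨_, R.pt_mem_arc_self 0⟩).1
        (show infDist (triMeshPoint δ x) (R.arc 0) < tol + δ by linarith)
      obtain ⟨b, hb, hyb⟩ := (infDist_lt_iff ⟨_, R.pt_mem_arc_self 2⟩).1
        (show infDist (triMeshPoint δ y) (R.arc 2) < tol + δ by linarith)
      have h1 := hd02 a ha b hb
      have h2 := dist_triangle4 a (triMeshPoint δ x) (triMeshPoint δ y) b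
      have h3 : dist a (triMeshPoint δ x) < tol + δ := by rwa [dist_comm] at hxa
      linarith
    -- a site of `G` adjacent to an off-`G` site near `A₁` (resp. `A₃`) lies on the discrete arc `0` (resp. `2`)
    have harc : ∀ (j : Fin 4) (a a' : Site 2), (j = 0 ∨ j = 2) → a' ∈ W.support → a ∈ G.verts → a' ∉ G.verts →
        triGraph.Adj a a' → infDist (triMeshPoint δ a') (R.arc j) ≤ tol → a ∈ G.arc j := by
      intro j a a' hj ha' haG ha'G haa' ha'j
      obtain ⟨i, hi⟩ := exists_mem_arc_of_adj_not_mem G haG ha'G haa'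
      obtain ⟨z, hz, hdz⟩ := (harcs i).1 a hi
      obtain ⟨q, hq, hq'⟩ := (infDist_lt_iff ⟨_, R.pt_mem_arc_self j⟩).1
        (show infDist (triMeshPoint δ a') (R.arc j) < tol + δ by linarith)
      have hda : dist (triMeshPoint δ a) (triMeshPoint δ a') = δ := by
        rw [dist_triMeshPoint_of_triGraph_adj haa', abs_of_pos hδ]
      have hzq : dist q z < 2 * ε₁ + 2 * δ + tol := by
        have h1 := dist_triangle4 q (triMeshPoint δ a') (triMeshPoint δ a) z
        have h2 : dist q (triMeshPoint δ a') < tol + δ := by rwa [dist_comm] at hq'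
        have h3 : dist (triMeshPoint δ a') (triMeshPoint δ a) = δ := by rw [dist_comm]; exact hda
        linarith
      have hqfar : ∀ k, ρ / 2 ≤ dist q (R.pt k) := fun k => by
        have := dist_triangle (triMeshPoint δ a') q (R.pt k)
        linarith [hfar a' ha' k]
      have hqarc : q ∈ R.arc 0 ∨ q ∈ R.arc 2 := by
        rcases hj with rfl | rfl
        · exact Or.inl hq
        · exact Or.inr hq
      have hq13 := le_dist_of_mem_arc_zero_two R hκ hsep hqarc hqfar
      -- `z ∈ R.arc i` is within `2ε₁ + 2δ + tol` of `q`: this forces `i = j`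
      have hi02 : ∀ q' ∈ R.arc 0, ∀ z' ∈ R.arc 2, dist q' z' < 2 * ε₁ + 2 * δ + tol → False := fun q' hq' z' hz' hd => by
        linarith [hd02 q' hq' z' hz']
      rcases hj with rfl | rfl
      · fin_cases i
        · exact hi
        · exact absurd (hq13 z (Or.inl hz)) (by linarith)
        · exact (hi02 q hq z hz hzq).elim
        · exact absurd (hq13 z (Or.inr hz)) (by linarith)
      · fin_cases i
        · exact (hi02 z hz q hq (by rwa [dist_comm])).elim
        · exact absurd (hq13 z (Or.inl hz)) (by linarith)
        · exact hi
        · exact absurd (hq13 z (Or.inr hz)) (by linarith)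
    refine isOpenCrossing_of_run G (fun x => x ∉ G.verts ∧ infDist (triMeshPoint δ x) (R.arc 0) ≤ tol)
      (fun x => x ∉ G.verts ∧ infDist (triMeshPoint δ x) (R.arc 2) ≤ tol) (PathIn.of_walk W fun x hx => hx)
      (fun x hx => (hW x hx).2) ?_ (fun x hx => hx.1) (fun x hx => hx.1) ?_ ?_ ?_ ?_ ?_
    · intro x hx hxG
      have hxΩ : triMeshPoint δ x ∈ R.carrier := (hW x hx).1
      rcases near_arcs_of_not_mem_fill R T hdist2 hκ (by linarith) hκ0 (by linarith) hxΩ (hfar x hx)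
        (fun h' => hxG (hKG x h')) with h0 | h2
      · exact Or.inl ⟨hxG, h0.le⟩
      · exact Or.inr ⟨hxG, h2.le⟩
    · rintro x - y - hxy ⟨-, hx0⟩ ⟨-, hy2⟩
      exact hexcl x y hxy hx0 hy2
    · refine ⟨fun huG => ?_, hu.trans (by linarith)⟩
      have := (hGfar u huG (hW u W.start_mem_support).1 (hfar u W.start_mem_support)).1
      linarith
    · refine ⟨fun hvG => ?_, hv.trans (by linarith)⟩
      have := (hGfar v hvG (hW v W.end_mem_support).1 (hfar v W.end_mem_support)).2
      linarith
    · rintro a - a' ha' haG ha'a ⟨ha'G, ha'0⟩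
      exact harc 0 a a' (Or.inl rfl) ha' haG ha'G ha'a.symm ha'0
    · rintro b - b' hb' hbG hbb' ⟨hb'G, hb'2⟩
      exact harc 2 b b' (Or.inr rfl) hb' hbG hb'G hbb' hb'2
  -- the estimate
  have hcorner : ∀ i : Fin 4, (triSitePercolation half).real (triAnnulusCrossing true δ (R.pt i) ρ r₂) ≤ (ρ / r₂) ^ α :=
    fun i => hbound true δ (R.pt i) ρ r₂ hδ (by linarith) hρr
  have hsum := sum_fin_four_le hcorner
  calc (triSitePercolation half).real {ω | ∃ u v : Site 2, infDist (triMeshPoint δ u) (R.arc 0) ≤ s * δ ∧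
        infDist (triMeshPoint δ v) (R.arc 2) ≤ s * δ ∧ ω ∈ siteConnIn triGraph (triMeshVertices R.carrier δ) u v}
      ≤ (triSitePercolation half).real (G.openCrossing 0 2 ∪ ⋃ i : Fin 4, triAnnulusCrossing true δ (R.pt i) ρ r₂) :=
        measureReal_mono hsub (measure_ne_top _ _)
    _ ≤ (triSitePercolation half).real (G.openCrossing 0 2) +
          (triSitePercolation half).real (⋃ i : Fin 4, triAnnulusCrossing true δ (R.pt i) ρ r₂) := measureReal_union_le _ _
    _ ≤ G.openCrossingProb 0 2 + ∑ i : Fin 4, (triSitePercolation half).real (triAnnulusCrossing true δ (R.pt i) ρ r₂) := by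
        gcongr
        · exact le_rfl
        · exact measureReal_iUnion_fintype_le _
    _ ≤ G.openCrossingProb 0 2 + ε := by linarith

/-! ## §4 Assembly: a discrete approximation dominating the crude event -/

/-- **The shorter–fatter discrete approximations dominate the crude event.** For `R` with boundary of
index `1` and a slack `s ≥ 0` there are a discrete approximation `G⁺_δ` of `R` (`IsDiscreteApprox`, the
diagonal selection of levels of `tri_exists_discreteApprox_proof`) and `e(δ) → 0` with
`P(crude_s(R, δ)) ≤ P(G⁺_δ has an open crossing from arc 0 to arc 2) + e(δ)` for all small `δ`.
[cite: BollobasRiordan2006, Ch. 7 Lemma 14 p. 184, proof p. 195, Claim 21 p. 193] -/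
theorem exists_discreteApprox_crude : ∀ (R : ConformalRectangle), (∀ z ∈ R.carrier, R.index z = 1) → ∀ {s : ℝ}, 0 ≤ s →
    ∃ Gp : ℝ → TriMarkedDomain 4, IsDiscreteApprox R Gp ∧
      ∃ e : ℝ → ℝ, Tendsto e (𝓝[>] 0) (𝓝 0) ∧ ∀ᶠ δ in 𝓝[>] (0 : ℝ),
        (triSitePercolation half).real {ω | ∃ u v : Site 2, Metric.infDist (triMeshPoint δ u) (R.arc 0) ≤ s * δ ∧
            Metric.infDist (triMeshPoint δ v) (R.arc 2) ≤ s * δ ∧ ω ∈ siteConnIn triGraph (triMeshVertices R.carrier δ) u v} ≤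
          (Gp δ).openCrossingProb 0 2 + e δ := by
  intro R hR1 s hs
  classical
  obtain ⟨T⟩ := R.toJordanDomain.nonempty_tubeData
  -- local connectivity data at the scales `γ_k = 1/(k+1)` (Claim 21, uniform in the level)
  have hc : ∀ γ > (0 : ℝ), ∃ η > (0 : ℝ), ∀ (h : ℝ) (hh : 0 < h) (hh1 : h ≤ 1 / 2),
      ∃ δ₁ > (0 : ℝ), ∀ (δ : ℝ) (hδ : 0 < δ)
        (hc₀ : baseSite T.z₀ δ ∈ innerCoarse (R.collarRect T (MarkedDomain.abs_le_one_of_sign σp_sign) hh hh1).carrier δ), δ < δ₁ →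
        (∀ x ∈ (innerApprox (R.collarRect T (MarkedDomain.abs_le_one_of_sign σp_sign) hh hh1).toJordanDomain hδ hc₀).verts,
          ∀ y ∈ (innerApprox (R.collarRect T (MarkedDomain.abs_le_one_of_sign σp_sign) hh hh1).toJordanDomain hδ hc₀).verts,
            dist (triMeshPoint δ x) (triMeshPoint δ y) < η →
            PathIn triGraph (((innerApprox (R.collarRect T (MarkedDomain.abs_le_one_of_sign σp_sign) hh hh1).toJordanDomain hδ hc₀).verts :
              Set (Site 2)) ∩ {v | dist (triMeshPoint δ x) (triMeshPoint δ v) < γ}) x y) ∧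
        (∀ w ∈ triFacesIn (innerApprox (R.collarRect T (MarkedDomain.abs_le_one_of_sign σp_sign) hh hh1).toJordanDomain hδ hc₀).verts,
          ∀ z ∈ triFacesIn (innerApprox (R.collarRect T (MarkedDomain.abs_le_one_of_sign σp_sign) hh hh1).toJordanDomain hδ hc₀).verts,
            dist ((δ : ℂ) * hexCenter w) ((δ : ℂ) * hexCenter z) < η →
            Relation.ReflTransGen (fun F F' : HexVertex => hexGraph.Adj F F' ∧
              F' ∈ triFacesIn (innerApprox (R.collarRect T (MarkedDomain.abs_le_one_of_sign σp_sign) hh hh1).toJordanDomain hδ hc₀).verts ∧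
              dist ((δ : ℂ) * hexCenter w) ((δ : ℂ) * hexCenter F') < 2 * γ) w z) := by
    intro γ hγ
    obtain ⟨ηs, hηs, hsite⟩ := site_conn_collar R T hγ
    obtain ⟨ηf, hηf, hface⟩ := face_conn_collar R T hγ
    refine ⟨min ηs ηf, lt_min hηs hηf, fun h hh hh1 => ⟨min ηs ηf, lt_min hηs hηf, fun δ hδ hc₀ hδlt => ⟨?_, ?_⟩⟩⟩
    · intro x hx y hy hxy
      exact hsite σp _ h hh hh1 δ hδ hc₀ (hδlt.trans_le (min_le_left _ _)) x hx y hy (hxy.trans_le (min_le_left _ _))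
    · intro w hw z hz hwz
      exact hface σp _ h hh hh1 δ hδ hc₀ (hδlt.trans_le (min_le_right _ _)) w hw z hz (hwz.trans_le (min_le_right _ _))
  choose η hη hck using fun k : ℕ => hc (1 / ((k : ℝ) + 1)) (by positivity)
  set θ : ℕ → ℝ := fun k => 1 / ((k : ℝ) + 1) with hθ
  have hθ0 : ∀ k, 0 < θ k := fun k => by positivity
  -- the per-level predicate
  set P : ℝ → ℝ → Prop := fun ε δ => ∃ Gp : TriMarkedDomain 4, LevelProp R T η θ ε δ Gp ∧
    (triSitePercolation half).real {ω | ∃ u v : Site 2, infDist (triMeshPoint δ u) (R.arc 0) ≤ s * δ ∧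
        infDist (triMeshPoint δ v) (R.arc 2) ≤ s * δ ∧ ω ∈ siteConnIn triGraph (triMeshVertices R.carrier δ) u v} ≤
      Gp.openCrossingProb 0 2 + ε with hP
  have hPall : ∀ ε > 0, ∃ δ₀ > 0, ∀ δ, 0 < δ → δ < δ₀ → P ε δ := by
    intro ε hε
    obtain ⟨hp, hhp, hhp1, hpε, hz₀p, δp, hδp, hlevp⟩ := level_crude R T hR1 hs hε
    have hkN : ∀ k : ℕ, ε ≤ θ k → k < ⌈1 / ε⌉₊ + 1 := by
      intro k hk
      have h1 : ε ≤ 1 / ((k : ℝ) + 1) := hk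
      have h2 : (k : ℝ) + 1 ≤ 1 / ε := by
        rw [le_div_iff₀ hε]; rw [le_div_iff₀ (by positivity)] at h1; linarith
      have h3 : (k : ℝ) < ⌈1 / ε⌉₊ + 1 := by linarith [Nat.le_ceil (1 / ε)]
      exact_mod_cast h3
    obtain ⟨dp, hdp0, hdpk⟩ : ∃ dp : ℕ → ℝ, (∀ k, 0 < dp k) ∧ ∀ k, ∀ (δ : ℝ) (hδ : 0 < δ)
        (hc₀ : baseSite T.z₀ δ ∈ innerCoarse (R.collarRect T (MarkedDomain.abs_le_one_of_sign σp_sign) hhp hhp1).carrier δ),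
        δ < dp k → _ := by
      choose dp hdp0 hdpk using fun k => hck k hp hhp hhp1
      exact ⟨dp, hdp0, hdpk⟩
    obtain ⟨Dp, hDp, hDpk⟩ := exists_pos_le_forall_lt hdp0 (⌈1 / ε⌉₊ + 1)
    refine ⟨min δp Dp, by positivity, fun δ hδ hδlt => ?_⟩
    have hδp' : δ < δp := hδlt.trans_le (min_le_left _ _)
    have hδDp : δ < Dp := hδlt.trans_le (min_le_right _ _)
    obtain ⟨hc₀p, Gp, hGpv, harcp, hfillp, hdensep, hsandp⟩ := hlevp δ hδ hδp'
    refine ⟨Gp, ⟨harcp, hfillp, hdensep, fun k hk => ?_⟩, hsandp⟩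
    have := hdpk k δ hδ hc₀p (hδDp.trans_le (hDpk k (hkN k hk)))
    rw [← hGpv] at this
    exact this
  obtain ⟨e, he, hepos, heP⟩ := exists_scale_tendsto hPall
  -- the family
  obtain ⟨δs, hδs⟩ := heP.exists
  set G₀ : TriMarkedDomain 4 := hδs.choose with hG₀
  set Gp : ℝ → TriMarkedDomain 4 := fun δ => if hPδ : P (e δ) δ then hPδ.choose else G₀ with hGp
  have hspec : ∀ δ, P (e δ) δ → LevelProp R T η θ (e δ) δ (Gp δ) ∧
      (triSitePercolation half).real {ω | ∃ u v : Site 2, infDist (triMeshPoint δ u) (R.arc 0) ≤ s * δ ∧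
        infDist (triMeshPoint δ v) (R.arc 2) ≤ s * δ ∧ ω ∈ siteConnIn triGraph (triMeshVertices R.carrier δ) u v} ≤
      (Gp δ).openCrossingProb 0 2 + e δ := by
    intro δ hPδ
    have h1 : Gp δ = hPδ.choose := by simp only [hGp, dif_pos hPδ]
    rw [h1]
    exact hPδ.choose_spec
  have he2 : Tendsto (fun δ => 2 * e δ) (𝓝[>] 0) (𝓝 0) := by simpa using he.const_mul 2
  have hsmall : ∀ c > 0, ∀ᶠ δ in 𝓝[>] (0 : ℝ), e δ < c := fun c hc => he (Iio_mem_nhds hc)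
  have hG : ∀ᶠ δ in 𝓝[>] (0 : ℝ), LevelProp R T η θ (e δ) δ (Gp δ) := heP.mono fun δ hδ => (hspec δ hδ).1
  refine ⟨Gp, ⟨⟨fun δ => 2 * e δ, he2, hG.mono fun δ hδ i => ⟨fun z hz => ?_, fun y hy => ?_⟩⟩,
    ⟨fun δ => 2 * e δ, he2, hG.mono fun δ hδ z hz => ?_⟩, fun K hK hKΩ => ?_, fun γ hγ => ?_, fun γ hγ => ?_⟩,
    e, he, heP.mono fun δ hδ => (hspec δ hδ).2⟩
  · obtain ⟨y, hy, hd⟩ := (hδ.arcs i).2 z hz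
    exact ⟨_, ⟨y, hy, rfl⟩, by rw [dist_comm]; exact hd.le⟩
  · obtain ⟨y', hy', rfl⟩ := hy
    obtain ⟨z, hz, hd⟩ := (hδ.arcs i).1 y' hy'
    exact ⟨z, hz, hd.le⟩
  · obtain ⟨w, hw, hd⟩ := hδ.dense z hz
    exact ⟨w, hw, hd.le⟩
  · -- fill: `K ⊆ Φ(B̄(0, r))` for some `r < 1`
    have hKc : IsCompact (T.Ci.φ.symm '' K) := hK.image_of_continuousOn (T.Ci.φ.symm.continuousOn.mono hKΩ)
    have hKball : T.Ci.φ.symm '' K ⊆ ball (0 : ℂ) 1 := by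
      rintro _ ⟨x, hx, rfl⟩
      have := T.Ci.φ.symm.toPartialEquiv.map_source (x := x) (by rw [T.Ci.φ.symm.source_eq]; exact hKΩ hx)
      rwa [T.Ci.φ.symm.target_eq] at this
    obtain ⟨r, hr1, hKr⟩ : ∃ r < 1, ∀ u ∈ T.Ci.φ.symm '' K, ‖u‖ ≤ r := by
      rcases (T.Ci.φ.symm '' K).eq_empty_or_nonempty with h0 | hne
      · exact ⟨0, one_pos, by rw [h0]; simp⟩
      · obtain ⟨u₀, hu₀, hmax⟩ := hKc.exists_isMaxOn hne continuous_norm.continuousOn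
        exact ⟨‖u₀‖, mem_ball_zero_iff.1 (hKball hu₀), fun u hu => hmax hu⟩
    filter_upwards [hG, hsmall ((1 - r) / 2) (by linarith)] with δ hδ hδs x hx
    refine hδ.fill x ⟨T.Ci.φ.symm (triMeshPoint δ x), mem_closedBall_zero_iff.2 ?_, ?_⟩
    · linarith [hKr _ ⟨_, hx, rfl⟩]
    · have hxΩ := hKΩ hx
      rw [T.Ci.eqOn (hKball ⟨_, hx, rfl⟩)]
      exact T.Ci.φ.apply_symm_apply hxΩ
  · -- site connectivity
    obtain ⟨k, hk⟩ := exists_nat_one_div_lt hγ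
    refine ⟨η k, hη k, ?_⟩
    filter_upwards [hG, hsmall (θ k) (hθ0 k)] with δ hδ hδs x hx y hy hxy
    exact (hδ.conn k hδs.le).1 x hx y hy hxy |>.mono (inter_subset_inter_right _ fun v (hv : _ < _) => hv.trans hk)
  · -- local connectivity of faces
    obtain ⟨k, hk⟩ := exists_nat_one_div_lt hγ
    refine ⟨η k, hη k, ?_⟩
    filter_upwards [hG, hsmall (θ k) (hθ0 k)] with δ hδ hδs w hw z hz hwz
    have hpath := (hδ.conn k hδs.le).2 w hw z hz hwz
    have hp : (fun F F' : HexVertex => hexGraph.Adj F F' ∧ F' ∈ (Gp δ).faces ∧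
        dist ((δ : ℂ) * hexCenter w) ((δ : ℂ) * hexCenter F') < 2 * (1 / ((k : ℝ) + 1))) ≤
        (fun F F' : HexVertex => hexGraph.Adj F F' ∧ F' ∈ (Gp δ).faces ∧ dist ((δ : ℂ) * hexCenter w) ((δ : ℂ) * hexCenter F') < 2 * γ) :=
      fun F F' hFF' => ⟨hFF'.1, hFF'.2.1, by linarith [hFF'.2.2]⟩
    exact Relation.ReflTransGen.mono hp w z hpath


end Summit.CriticalPhenomena.CardyFormulaZ2.Theorems.IKLinearTransport.PinnedDiagramExchange
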